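import Summits.QuantumFields.YangMills.Theorems.BalabanUVNodesN15KingModelDecayAtMassRate

/-!
# BalabanUVNodes ∕ N15 — THE KING-MODEL RUNG (PART Ϸ-s): THE SUP-NORM CLUSTERING BOUND AT THE MASS RATE — `|S₂^{ℝ}(z)| ≤ S₂^{ℝ}(e₀)e^{m}·e^{−m‖z‖_∞}` for every
# `z ≠ 0` (Track A, DAG node N15 = NE2; FAN-OUT v1.1 §N15 s3 «KING-MODEL RUNG»; part Ϸ-r in the coordinate of largest modulus + part Ϝ-m's permutation symmetry;
# count-neutral)

HONEST FRAMING.  Count-neutral (cell `pub-ymgap`, seat `pub-ymgap-dag-n15-e` g34; `--supports stmt-QuantumFields-27366 --as helper` = K3⁸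
`SpineGivenEndpointR13SepCoPHV`).  King's `A = 0`, `g = 0` model ([King1986] C. King, Commun. Math. Phys. **102** (1986) 649–677; `S₂^{ℝ}` = the infinite-volume
two-point function of the unit-block averages of the continuum free field of mass `m = √m²`, (4.5) p.670, (4.36) p.674; Thm 3.3 (3.6) p.656 prints the clustering
`|C^{(k)}(0,A)(x,y)| ≤ Ce^{−δ₀|x−y|}` with an UNSPECIFIED rate `δ₀ > 0`).  Part Ϸ-r bounds `|S₂^{ℝ}(z)|` by `S₂^{ℝ}(e_ν)e^{m}e^{−m|z_ν|}` in EVERY direction `ν` with `|z_ν| ≥ 1`; choosing `ν` with `|z_ν| = ‖z‖_∞ =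
max_μ|z_μ|` (`≥ 1` for `z ≠ 0`) and using `S₂^{ℝ}(e_ν) = S₂^{ℝ}(e₀)` (coordinate-permutation invariance, part Ϝ-m) gives the direction-free form
`|S₂^{ℝ}(z)| ≤ S₂^{ℝ}(e₀)e^{m}·e^{−m‖z‖_∞}`: exponential clustering at the rate `m` ITSELF in the lattice sup-norm (King's (3.6) has an unspecified `δ₀ > 0`; part Ϸ-c had
every `c < m`).  [v1.1 DOC-ONLY edition, ERRATUM-3: v1.0 wrote «King's (3.6) has `(1−ε)m`» — (3.6) prints `Ce^{−δ₀|x−y|}` with no `δ₀ = (1−ε)m`; corrected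
here and in the framing above; declarations byte-identical.]  NOT a node discharge (N15 is booked through n15-a's knit, untouched here); nothing Bałaban ∕ continuum-Yang–Mills ∕ `ℝ⁴` ∕ OS ∕ Clay.  0 `sorry`, 0 def;
standard axioms.

WHAT THIS FILE PROVES (kernel).  `single_comp_swap` (`(te_ν)∘swap(0,ν) = te₀`), ★ `kingS2Inf_single_eq_single_zero` (`S₂^{ℝ}(te_ν) = S₂^{ℝ}(te₀)`), `exists_natAbs_eq_sup`,
`one_le_sup_natAbs`, ★★★ **`abs_kingS2Inf_le_exp_mass_supNorm`** (`|S₂^{ℝ}(z)| ≤ S₂^{ℝ}(e₀)e^{√m²}e^{−√m²·max_μ|z_μ|}`, `z ≠ 0`).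

HONEST SCOPE.  King's free model, `K = ∞`, infinite volume; lattice sup-norm.  N15 untouched; counts unmoved.  Locators (use): [King1986] (4.5) p.670, (4.36) p.674,
Thm 3.3 (3.6) p.655, Thm 2.1 (2.22) p.654.
-/

noncomputable section

open scoped BigOperators Topology
open Filter MeasureTheory Set

namespace Summit.QuantumFields.YangMills.BalabanUVNodes.N15KingModelRung.OptimalDecay

variable {d : ℕ}

/-- `(te_ν)∘swap(0,ν) = te₀`. [folklore] -/
theorem single_comp_swap (ν : Fin (d + 1)) (t : ℤ) :
    (Pi.single ν t : Fin (d + 1) → ℤ) ∘ (Equiv.swap (0 : Fin (d + 1)) ν) = Pi.single 0 t := by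
  ext μ
  simp only [Function.comp_apply, Pi.single_apply]
  by_cases h : μ = 0
  · subst h
    simp
  · rw [if_neg h]
    have hne : (Equiv.swap (0 : Fin (d + 1)) ν) μ ≠ ν := by
      intro h2
      have h3 := congrArg (Equiv.swap (0 : Fin (d + 1)) ν) h2
      simp at h3
      exact h h3
    simp [hne]

/-- ★ `S₂^{ℝ}(te_ν) = S₂^{ℝ}(te₀)` (coordinate-permutation invariance). [cite: King1986, Thm 2.1 (2.22) p.654] -/
theorem kingS2Inf_single_eq_single_zero (m2 : ℝ) (ν : Fin (d + 1)) (t : ℤ) :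
    kingS2Inf m2 (Pi.single ν t) = kingS2Inf m2 (Pi.single (0 : Fin (d + 1)) t) := by
  rw [← kingS2Inf_perm m2 (Pi.single ν t) (Equiv.swap (0 : Fin (d + 1)) ν), single_comp_swap]

/-- The sup-norm `max_μ|z_μ|` is attained. [folklore] -/
theorem exists_natAbs_eq_sup (z : Fin (d + 1) → ℤ) : ∃ ν, (Finset.univ.sup fun μ => (z μ).natAbs) = (z ν).natAbs := by
  obtain ⟨ν, _, hν⟩ := Finset.exists_mem_eq_sup (Finset.univ : Finset (Fin (d + 1))) Finset.univ_nonempty fun μ => (z μ).natAbs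
  exact ⟨ν, hν⟩

/-- `max_μ|z_μ| ≥ 1` for `z ≠ 0`. [folklore] -/
theorem one_le_sup_natAbs {z : Fin (d + 1) → ℤ} (hz : z ≠ 0) : 1 ≤ Finset.univ.sup fun μ => (z μ).natAbs := by
  obtain ⟨μ, hμ⟩ := Function.ne_iff.mp hz
  have h1 : 1 ≤ (z μ).natAbs := Int.natAbs_pos.mpr hμ
  exact h1.trans (Finset.le_sup (f := fun μ => (z μ).natAbs) (Finset.mem_univ μ))

/-- ★★★ **THE SUP-NORM CLUSTERING BOUND AT THE MASS RATE**: for `m² > 0` and every `z ≠ 0` in `ℤ^{d+1}`,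
`|S₂^{ℝ}(z)| ≤ S₂^{ℝ}(e₀)·e^{√m²}·e^{−√m²·max_μ|z_μ|}`. [cite: King1986, Thm 3.3 (3.6) p.655, Thm 2.1 (2.22)–(2.23) p.654] -/
theorem abs_kingS2Inf_le_exp_mass_supNorm {m2 : ℝ} (hm : 0 < m2) {z : Fin (d + 1) → ℤ} (hz : z ≠ 0) :
    |kingS2Inf m2 z| ≤ kingS2Inf m2 (Pi.single (0 : Fin (d + 1)) 1) * Real.exp (Real.sqrt m2)
        * Real.exp (-(Real.sqrt m2 * ((Finset.univ.sup fun μ => (z μ).natAbs : ℕ) : ℝ))) := by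
  obtain ⟨ν, hν⟩ := exists_natAbs_eq_sup z
  have h1 : 1 ≤ (z ν).natAbs := hν ▸ one_le_sup_natAbs hz
  have h := abs_kingS2Inf_le_exp_mass hm z ν h1
  rw [kingS2Inf_single_eq_single_zero] at h
  have habs : |(z ν : ℝ)| = ((z ν).natAbs : ℝ) := by
    rw [← Int.cast_abs, Int.abs_eq_natAbs, Int.cast_natCast]
  rw [habs, ← hν] at h
  exact h

end Summit.QuantumFields.YangMills.BalabanUVNodes.N15KingModelRung.OptimalDecay
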